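import Summits.HodgeConjecture.HodgeConjecture.Theorems.VHCAbelianSchemesRoadServedFibreAlgebraic
import Summits.HodgeConjecture.HodgeConjecture.Theorems.VHCAbelianSchemesRoadDiagonalCM
import Literature.AlgebraicGeometry.HodgeTheory.MiddleHodgeOfAffineComplementSections
import HarnessLib

/-!
# Road b02 (`VHCAbelianSchemesRoad`) — SERVED COMPACT PENCILS and THE CM-ANCHORED INSTANCE: `HC_AV` from the door, André's Lemme 6.3.1
# and twisted carriers ON CM ABELIAN VARIETIES ONLY (cell-free; no `HC_CM` hypothesis, no curve residual, no K-SR♭∃)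

research route, not a corollary; conditional on HC_CM plus one named minimal statement.

PART AA-e proved: door ∧ anchored carrier ∧ served fibre ⟹ `W` algebraic on every fibre, for pencils over smooth irreducible AFFINE curves
with quasi-projective total space. André's pencils (Lemme 6.3.1, the tree's REFEREED named fact `andre1996_cmAnchoredPencil`, route binder
`AndreCMAnchoredPencil`) are COMPACT: smooth projective total space over a smooth projective curve, abelian fibres, a section, a CM fibre.
This file removes «affine» (§1: a compact smooth curve is just as thick — proper closed subsets are finite) and instantiates the anchor data at
CM ABELIAN VARIETIES (§3):

* §1 `compactCurve_not_subset_iUnion_of_not_countable` (the thickness lemma with `CompactSpace` in place of `IsAffine`);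
  **`mem_algebraicClasses_of_anchoredCarrierAt_of_hasServedFibre_of_compactSpace`** — door ∧ anchored carrier ∧ served fibre ⟹ `W`
  algebraic on EVERY fibre, for smooth projective families over a smooth irreducible one-dimensional QUASI-PROJECTIVE COMPACT base with
  quasi-projective total space; **`mem_algebraicClasses_compactPencil_of_anchoredCarrierAt_of_hasServedFibre`** — the same for every
  compact pencil of abelian varieties (`IsCompactAbelianPencil`: everything is projective, nothing residual).
* §2 The CM anchor data (spelled inline, no definition): anchors `cm n X θ :≡ (∃ A₀ CM abelian, dim A₀ = n, A₀.X ≅ X) ∧ θ a polarisation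
  class of X`; served classes `hdg n p X θ :≡ {w | w of type (p,p)}`. `hasServedFibre_compactPencil_of_cmFibre` — an André pencil (compact,
  with a CM fibre) IS served for every fibrewise rational `(p,p)` class, the polarising global class being the relative hyperplane class of the
  projective total space.
* §3 **`hodgeConjectureFor_of_cmAnchoredPencil_of_cmAnchoredCarrierAt`** — for ONE abelian variety `A` of dimension `g`: André's Lemme 6.3.1
  ∧ the door for `𝒪` ∧ `AnchoredCarrierAt 𝒪 (2g) p cm hdg` for the mid-range codimensions `2 ≤ p ≤ g − 2` ⟹ `HodgeConjectureFor g A.X`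
  (off the mid-range: Lefschetz, PART W; in it: Lemme 6.3.1 gives a compact pencil of relative dimension `2g` through `q·c` with a CM fibre,
  served by §2, algebraic everywhere by §1, pulled back to `A` by `map_mem_algebraicClasses_of_abelianVariety`);
  **`forall_hodgeConjectureFor_of_cmAnchoredPencil_of_cmAnchoredCarrierAt`** — `HC_AV` (as `∀ A, HodgeConjectureFor A.dim A.X`) from
  Lemme 6.3.1 ∧ door ∧ «CM-ANCHORED TWISTED CARRIERS»: on every complex scheme isomorphic to a CM abelian `n`-fold, for every polarisation class
  `θ` and every rational `(p,p)` class `w` (`2 ≤ p`, `2p + 4 ≤ n`), an `𝒪`-datum ON IT with `κ_p = a·w + c_p·θᵖ`, `a ≠ 0`, sides on the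
  `θ`-ray. For the road's door: `…_of_twistedPerfectDoorVHC_…` (per `C`).

READING (B_min bookkeeping of the AbelianAll cell, kernel edge): `HC_AV ⟸ AndreCMAnchoredPencil ∧ TwistedPerfectDoor ∧ CMTwistedCarriers`,
where `CMTwistedCarriers` is a statement about CM ABELIAN VARIETIES ONLY (countably many isomorphism classes) that STRENGTHENS `HC_CM`
(semiregular twisted representability instead of algebraicity; it implies `HC_CM` through the door and the constant pencil) — the road's
K-SR♭∃ (all pencils), its curve residual (Raynaud) and Lemmes 6.3.2–6.3.3 are NOT used. Gen-1's node (4) `CMAnchoredTransport` of this seat and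
Markman's secant mechanism are the two printed instances of PART AA-e's edge; this is the first in kernel form end to end.

What is NOT claimed: `CMTwistedCarriers`, the door, Lemme 6.3.1 (a REFEREED named fact, hypothesis by name), `HC_CM`, `HC_AV`, HC.
References: [cite: Andre1996Motifs, §6.3 Lemme 6.3.1 (p. 31) and a) (p. 33)] [cite: BuchweitzFlenner2003, §5 Thm. 5.1]
[cite: Bloch1972Semiregularity, Remark (7.5)] [cite: Markman2025SecantWeil, Thm. 1.5.1] [cite: CharlesSchnell2014Notes, Prop. 11.3.11 (proof)]
[cite: Fulton1998, §19.2 Cor. 19.2 (b)] [cite: Milne1999, §7 p. 72] [cite: Hartshorne1977, II Ex. 3.20 and III.10].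
-/

noncomputable section

open CategoryTheory CategoryTheory.Limits AlgebraicGeometry Topology

namespace Summit.HodgeConjecture.HodgeConjecture.Ring2.SemiregularRepresentatives

-- the cell's namespace repeats the summit name (`Summit.HodgeConjecture.HodgeConjecture…`), as in every `Ring2*` file
set_option linter.dupNamespace false

open Literature.AlgebraicGeometry Literature.AlgebraicGeometry.Motives
open Literature.AlgebraicGeometry.HodgeTheory
open Literature.AlgebraicTopology.SingularHomology
open Literature.Barriers.HodgeConjecture (divisorClassesSpan)
open Literature.AlgebraicGeometry.Andre1996 (andre1996_cmAnchoredPencil IsCMAnchoredPencilFor compactPencil_dim_eq_of_iso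
  compactPencil_irreducibleSpace_base compactPencil_smooth_base compactPencil_exists_abelianVariety_fiber_dim)
open Literature.AlgebraicGeometry.Milne1999 (IsOfCMType)
open Summit.HodgeConjecture.HodgeConjecture.Ring2.Binders
open Summit.Ventures.HSemireg (ObjClass LocalVariationalHodgeFor)

variable {𝒪 : ObjClass} {n p : ℕ}
variable {𝔄 : ∀ X : SchemeOver ℂ, complexBetti X 2 → Prop} {𝔖 : ∀ (X : SchemeOver ℂ), complexBetti X 2 → Set (complexBetti X (2 * p))}
variable {𝒳 S : SchemeOver ℂ} {f : 𝒳 ⟶ S}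

/-! ## §1 Compact bases: thickness, and algebraicity on every fibre of a served compact pencil -/

/-- **On a smooth irreducible QUASI-COMPACT curve an uncountable set of complex points is thick** (proper closed subsets are finite, each
with finitely many complex points): the affine thickness lemma `curve_not_subset_iUnion_of_not_countable` with `CompactSpace` in place of
`IsAffine` — so that smooth PROJECTIVE curves (the bases of André's compact pencils) are covered. [folklore]
[cite: Hartshorne1977, II Ex. 3.20 (dimension of curves)] -/
theorem compactCurve_not_subset_iUnion_of_not_countable {C : SchemeOver ℂ} [CompactSpace C.left] [IrreducibleSpace C.left]
    [AlgebraicGeometry.Smooth C.hom] (hdim : topologicalKrullDim C.left = 1) (Λ : Set (ComplexPoints C))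
    (hΛ : ¬ Λ.Countable) (Z : ℕ → Set C.left) (hZc : ∀ k, IsClosed (Z k)) (hZne : ∀ k, Z k ≠ Set.univ) :
    ¬ Λ ⊆ ⋃ k, {t : ComplexPoints C | t.pt ∈ Z k} := by
  intro hsub
  haveI : LocallyOfFiniteType C.hom := inferInstance
  haveI : IsLocallyNoetherian C.left := LocallyOfFiniteType.isLocallyNoetherian C.hom
  haveI : IsNoetherian C.left := {}
  exact hΛ ((Set.countable_iUnion fun k => (Theorems.finite_setOf_pt_mem
    (Theorems.finite_of_isClosed_ne_univ_of_topologicalKrullDim_le_one hdim.le (hZc k) (hZne k))).countable).mono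
      hsub)

/-- **DOOR ∧ ANCHORED CARRIER ∧ SERVED FIBRE ⟹ `W` ALGEBRAIC ON EVERY FIBRE, over a QUASI-PROJECTIVE QUASI-COMPACT base** (smooth, irreducible,
one-dimensional; total space quasi-projective) — PART AA-e §2 with the affine hypothesis on the base replaced by quasi-projective + compact
(both hold for affine AND for projective curves). [cite: CharlesSchnell2014Notes, Prop. 11.3.11 (proof)] [cite: BuchweitzFlenner2003, §5 Thm. 5.1]
[cite: Markman2025SecantWeil, Thm. 1.5.1] [cite: Andre1996Motifs, §6.3] -/
theorem mem_algebraicClasses_of_anchoredCarrierAt_of_hasServedFibre_of_compactSpace (hT : LocalVariationalHodgeFor 𝒪)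
    (hA : AnchoredCarrierAt 𝒪 n p 𝔄 𝔖) (hf : IsSmoothProjectiveFamily f n) (h𝒳 : IsQuasiProjectiveOver 𝒳)
    (hS : IsQuasiProjectiveOver S) (hSc : CompactSpace S.left) (hirr : IrreducibleSpace S.left) (hsm : AlgebraicGeometry.Smooth S.hom)
    (hdim : topologicalKrullDim S.left = 1) (W : complexBetti 𝒳 (2 * p))
    (hW : ∀ s : ComplexPoints S, IsRationalClass (complexBetti.map (fiberι f s) (2 * p) W) ∧
      IsOfHodgeType n (fiberOver f s) (2 * p) p p (complexBetti.map (fiberι f s) (2 * p) W))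
    (hsf : HasServedFibre n p 𝔄 𝔖 f W) (s : ComplexPoints S) :
    complexBetti.map (fiberι f s) (2 * p) W ∈ algebraicClasses (fiberOver f s) p := by
  haveI := hirr
  haveI := hSc
  haveI := hsm
  haveI : LocallyOfFiniteType S.hom := inferInstance
  exact Theorems.mem_algebraicClasses_of_thickSet charlesSchnell_algebraicityLocus_iUnion_closed_holds f hf h𝒳 hS hsm W
    {t : ComplexPoints S | complexBetti.map (fiberι f t) (2 * p) W ∈ algebraicClasses (fiberOver f t) p}
    (compactCurve_not_subset_iUnion_of_not_countable hdim _
      (not_countable_algebraicLocus_of_anchoredCarrierAt_of_hasServedFibre hT hA hf hirr hsm hdim W hW hsf))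
    (fun t ht => ht) s

/-- **Every served COMPACT PENCIL of abelian varieties is algebraic everywhere**: for `f : 𝒳 ⟶ S` a compact pencil of relative dimension `n`
(`IsCompactAbelianPencil`: `S` a smooth projective curve, `𝒳` smooth projective, abelian fibres, a section), the door, the anchored carrier
statement and a served fibre make every fibrewise rational `(p,p)` class algebraic on every fibre — NO curve residual (everything is
projective). [cite: Andre1996Motifs, §6.3 footnote (2) and Lemme 6.3.1] [cite: CharlesSchnell2014Notes, Prop. 11.3.11 (proof)]
[cite: Hartshorne1977, II Ex. 3.20 and III.10] -/
theorem mem_algebraicClasses_compactPencil_of_anchoredCarrierAt_of_hasServedFibre (hT : LocalVariationalHodgeFor 𝒪)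
    (hA : AnchoredCarrierAt 𝒪 n p 𝔄 𝔖) (hf : IsCompactAbelianPencil f n) (W : complexBetti 𝒳 (2 * p))
    (hW : ∀ s : ComplexPoints S, IsRationalClass (complexBetti.map (fiberι f s) (2 * p) W) ∧
      IsOfHodgeType n (fiberOver f s) (2 * p) p p (complexBetti.map (fiberι f s) (2 * p) W))
    (hsf : HasServedFibre n p 𝔄 𝔖 f W) (s : ComplexPoints S) :
    complexBetti.map (fiberι f s) (2 * p) W ∈ algebraicClasses (fiberOver f s) p := by
  have hdim : topologicalKrullDim S.left = 1 := by
    rw [topologicalKrullDim_left_eq_of_isSmoothProjective hf.isSmoothProjective_base]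
    rfl
  exact mem_algebraicClasses_of_anchoredCarrierAt_of_hasServedFibre_of_compactSpace hT hA hf.isSmoothProjectiveFamily
    (IsQuasiProjectiveOver.of_isProjectiveOver hf.isSmoothProjective_total.isProjectiveOver)
    (IsQuasiProjectiveOver.of_isProjectiveOver hf.isSmoothProjective_base.isProjectiveOver)
    (IsSmoothProjective.compactSpace_holds hf.isSmoothProjective_base) (compactPencil_irreducibleSpace_base hf)
    (compactPencil_smooth_base hf) hdim W hW hsf s

/-! ## §2 The CM anchor data; André's pencils are served -/

/-- **An André pencil is SERVED by the CM anchor data**: a compact pencil of abelian varieties of relative dimension `n` with a fibre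
`𝒳_t ≅ A₀.X`, `A₀` of CM type, has a served fibre for EVERY fibrewise rational `(p,p)` class `W`, with respect to the anchors «`X ≅` a CM
abelian `n`-fold, `θ` a polarisation class of `X`» and the served classes «of type `(p,p)`»: the relative hyperplane class of the projective
total space polarises every fibre (ring2-b02's `exists_forall_isPolarizationClass_map_fiberι`), `sₐ := t`.
[cite: Andre1996Motifs, Lemme 6.3.1 (ii)] [cite: VoisinHodgeI2002, Thm. 6.25, Thm. 7.10 and §7.1.2] [cite: Milne1999, §7 p. 72] -/
theorem hasServedFibre_compactPencil_of_cmFibre (hf : IsCompactAbelianPencil f n) {t : ComplexPoints S} (A₀ : AbelianVariety ℂ)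
    (e₀ : A₀.X ≅ fiberOver f t) (hA₀ : IsOfCMType A₀) (W : complexBetti 𝒳 (2 * p))
    (hW : ∀ s : ComplexPoints S, IsRationalClass (complexBetti.map (fiberι f s) (2 * p) W) ∧
      IsOfHodgeType n (fiberOver f s) (2 * p) p p (complexBetti.map (fiberι f s) (2 * p) W)) :
    HasServedFibre n p
      (fun X θ ↦ (∃ A₀ : AbelianVariety ℂ, A₀.dim = n ∧ IsOfCMType A₀ ∧ Nonempty (A₀.X ≅ X)) ∧ IsPolarizationClass n X θ)
      (fun X _ ↦ {w | IsOfHodgeType n X (2 * p) p p w}) f W := by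
  haveI : IsSeparated S.hom :=
    (IsQuasiProjectiveOver.of_isProjectiveOver hf.isSmoothProjective_base.isProjectiveOver).isSeparated
  obtain ⟨Θ, hΘ⟩ := exists_forall_isPolarizationClass_map_fiberι f hf.isSmoothProjectiveFamily
    (IsQuasiProjectiveOver.of_isProjectiveOver hf.isSmoothProjective_total.isProjectiveOver)
  exact ⟨t, Θ, fun s ↦ (hΘ s).isRationalClass,
    fun s ↦ isOfHodgeType_of_mem_algebraicClasses_of_isSmoothProjective (hf.isSmoothProjectiveFamily.isSmoothProjective s) 1
      (hΘ s).mem_algebraicClasses,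
    ⟨⟨A₀, compactPencil_dim_eq_of_iso hf e₀, hA₀, ⟨e₀⟩⟩, hΘ t⟩, (hW t).2⟩

/-! ## §3 `HC_AV` from André's Lemme 6.3.1, the door and CM-anchored carriers — cell-free -/

/-- **HC FOR ONE ABELIAN VARIETY `A` OF DIMENSION `g` from Lemme 6.3.1, the door and CM-ANCHORED CARRIERS at relative dimension `2g`**
(cell-free; no `HC_CM`, no curve residual, no K-SR♭∃). Codimensions `p ≤ 1`, `p ≥ g − 1` are Lefschetz (PART W). Otherwise Lemme 6.3.1
gives a compact pencil of relative dimension `2g` through `q·c` (`q ≠ 0`, via `g' : A ⟶ A₁ ≅ 𝒳_s`) with a CM fibre; it is served (§2); the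
anchored carrier statement for the CM anchor data and the door make `W` algebraic on every fibre (§1); pull back along `e₁`, `g'`
(`map_mem_algebraicClasses_of_abelianVariety`) and divide by `q`. [cite: Andre1996Motifs, Lemme 6.3.1 (p. 31) and §6.3 a) (p. 33)]
[cite: BuchweitzFlenner2003, §5 Thm. 5.1] [cite: Fulton1998, §19.2 Cor. 19.2 (b)] [cite: Milne1999, §7 p. 72] -/
theorem hodgeConjectureFor_of_cmAnchoredPencil_of_cmAnchoredCarrierAt (h₂₁ : andre1996_cmAnchoredPencil)
    (hT : LocalVariationalHodgeFor 𝒪) (A : AbelianVariety ℂ)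
    (hcar : ∀ p : ℕ, 2 ≤ p → p + 2 ≤ A.dim → AnchoredCarrierAt 𝒪 (2 * A.dim) p
      (fun X θ ↦ (∃ A₀ : AbelianVariety ℂ, A₀.dim = 2 * A.dim ∧ IsOfCMType A₀ ∧ Nonempty (A₀.X ≅ X)) ∧
        IsPolarizationClass (2 * A.dim) X θ)
      (fun X _ ↦ {w | IsOfHodgeType (2 * A.dim) X (2 * p) p p w})) :
    HodgeConjectureFor A.dim A.X := by
  have hA : IsSmoothProjective A.dim A.X := AbelianVariety.isSmoothProjective_holds
  refine (hodgeConjectureFor_iff_of_isSmoothProjective nonempty_hodgeModel_holds hA).2 ?_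
  intro p c hc hpp
  by_cases hoff : p ≤ 1 ∨ A.dim ≤ p + 1
  · exact (mem_algebraicClasses_and_divisorClassesSpan_of_offMidRange hA hoff c hc hpp).1
  obtain ⟨𝒳, S, f, hf, s, t, W, A₁, A₀, e₁, g, q, hW, hq, hgc, ⟨e₀⟩, hA₀⟩ := h₂₁ A hA p c hc hpp
  -- the pencil is served at its CM fibre; the door and the CM-anchored carriers make `W` algebraic everywhere
  have h₁ : complexBetti.map (fiberι f s) (2 * p) W ∈ algebraicClasses (fiberOver f s) p :=
    mem_algebraicClasses_compactPencil_of_anchoredCarrierAt_of_hasServedFibre hT (hcar p (by omega) (by omega)) hf W hW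
      (hasServedFibre_compactPencil_of_cmFibre hf A₀ e₀ hA₀ W hW) s
  -- pull back to `A` and divide by `q`
  have h₂ : complexBetti.map e₁.hom (2 * p) (complexBetti.map (fiberι f s) (2 * p) W) ∈ algebraicClasses A₁.X p :=
    (mem_algebraicClasses_map_iff_of_iso e₁).2 h₁
  have h₃ : (q : ℂ) • c ∈ algebraicClasses A.X p := by
    rw [← hgc]
    exact map_mem_algebraicClasses_of_abelianVariety hA A₁ g.hom.hom.hom h₂
  exact (Submodule.smul_mem_iff _ (Rat.cast_ne_zero.2 hq)).1 h₃

/-- **`HC_AV` FROM ANDRÉ'S LEMME 6.3.1, THE DOOR AND CM-ANCHORED CARRIERS** (cell-free, kernel): if `𝒪` satisfies its local variational Hodge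
statement and, for every relative dimension `n` and every codimension `p` with `2 ≤ p`, `2p + 4 ≤ n` (the range Lemme 6.3.1 uses at
`n = 2·dim A`: `2 ≤ p ≤ dim A − 2`), every complex scheme isomorphic to a CM abelian `n`-fold carries, for every polarisation class `θ` and every rational `(p,p)` class `w`, an
`𝒪`-datum with `κ_p = a·w + c_p·θᵖ`, `a ≠ 0`, sides on the `θ`-ray — then every rational Hodge class on every complex abelian variety is
algebraic. The CM-only hypothesis STRENGTHENS `HC_CM` (which it implies through the door); the road's K-SR♭∃, the curve residual and Lemmes
6.3.2–6.3.3 are not used. [cite: Andre1996Motifs, §6.3 Lemme 6.3.1 and a)] [cite: BuchweitzFlenner2003, §5 Thm. 5.1]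
[cite: Bloch1972Semiregularity, Remark (7.5)] [cite: Milne1999, §7 p. 72] -/
theorem forall_hodgeConjectureFor_of_cmAnchoredPencil_of_cmAnchoredCarrierAt (h₂₁ : andre1996_cmAnchoredPencil)
    (hT : LocalVariationalHodgeFor 𝒪)
    (hcar : ∀ n p : ℕ, 2 ≤ p → 2 * p + 4 ≤ n → AnchoredCarrierAt 𝒪 n p
      (fun X θ ↦ (∃ A₀ : AbelianVariety ℂ, A₀.dim = n ∧ IsOfCMType A₀ ∧ Nonempty (A₀.X ≅ X)) ∧ IsPolarizationClass n X θ)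
      (fun X _ ↦ {w | IsOfHodgeType n X (2 * p) p p w})) :
    ∀ A : AbelianVariety ℂ, HodgeConjectureFor A.dim A.X :=
  fun A ↦ hodgeConjectureFor_of_cmAnchoredPencil_of_cmAnchoredCarrierAt h₂₁ hT A
    (fun p hp2 hpA ↦ hcar (2 * A.dim) p hp2 (by omega))

/-- **The same for the road's twisted door, per Chern character theory `C`** (route binders `AndreCMAnchoredPencil` — per name
`andre1996_cmAnchoredPencil` — and `TwistedPerfectDoorVHC C AdmTw`): CM-anchored TWISTED carriers give `HC_AV`.
[cite: Andre1996Motifs, §6.3 Lemme 6.3.1] [cite: Pridham2024Semiregularity, Cor. 2.25 and Rem. 2.27] [cite: Markman2025SecantWeil, Thm. 1.5.1] -/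
theorem forall_hodgeConjectureFor_of_twistedPerfectDoorVHC_of_cmAnchoredCarrierAt {C : ChernCharacterBetti} {Adm : PerfectAdmissibility}
    (h₂₁ : andre1996_cmAnchoredPencil) (hT : TwistedPerfectDoorVHC C Adm)
    (hcar : ∀ n p : ℕ, 2 ≤ p → 2 * p + 4 ≤ n → AnchoredCarrierAt (twistedReflexiveClass C Adm) n p
      (fun X θ ↦ (∃ A₀ : AbelianVariety ℂ, A₀.dim = n ∧ IsOfCMType A₀ ∧ Nonempty (A₀.X ≅ X)) ∧ IsPolarizationClass n X θ)
      (fun X _ ↦ {w | IsOfHodgeType n X (2 * p) p p w})) :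
    ∀ A : AbelianVariety ℂ, HodgeConjectureFor A.dim A.X :=
  forall_hodgeConjectureFor_of_cmAnchoredPencil_of_cmAnchoredCarrierAt h₂₁
    ((twistedPerfectDoorVHC_iff_localVariationalHodgeFor C Adm).1 hT) hcar

end Summit.HodgeConjecture.HodgeConjecture.Ring2.SemiregularRepresentatives

end
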